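import Mathlib
import Literature.NumberTheory.LFunctions.Zhang2022.Section7Step7u033Repaired
import Literature.NumberTheory.LFunctions.Zhang2022.Section7TailP2
import Literature.NumberTheory.LFunctions.Zhang2022.Section7DeltaFar
import Literature.NumberTheory.LFunctions.Zhang2022.Section7Eq711Assembly
import HarnessLib

/-!
# Zhang (2022) §7, the (7.13) range question (G-adj2-1): per-triple bounds on the FULL (7.2) support

Topic `Literature/NumberTheory/LFunctions/Zhang2022` (Landau–Siegel audit tree; verdict-neutral).
Y. Zhang, *Discrete mean estimates and the Landau–Siegel zero*, arXiv:2211.02515v1 (2022)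
[Zhang2022LandauSiegel] — **an unrefereed manuscript under adjudication**. D-0069 campaign, cell
`siegel-zhang`, §7 error-term subsection (tex L1984–L2058).

The adjudication's row G-adj2-1 records that the printed (7.13) restricts the triple sum to
`dhr < P₁` while the support (7.2) permits `dhr < PT⁻²` with `PT⁻² ≫ P₁` — a statement/proof
mismatch as printed. The repair disposition of the row extends the §7 error-leg estimates to the
full support range. This file supplies the two PER-TRIPLE inputs for triples in the extended
range (no restriction to `dhr < P₁`), with `1 < r < D`:

* `tail7P2X_le` — the `l > P²` tail of `𝔰(r,h,d;θ)` is `≤ exp(−c𝓛¹⁰)` whenever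
  `hr ≤ PT⁻²` and `d ≤ P`. Unlike the landed `Section7TailP2.step7bTruncP2_holds` (which runs
  over the printed triples, where `x = l/(phr) ≥ P^{0.496}/2` and Lemma 5.3 (ii) applies), the
  extended range only guarantees `x ≥ T²/2`, where the Gaussian-in-`log x` decay of Lemma 5.3 (ii)
  no longer beats the `P`-powers; the proof instead uses the uniform far-bound of Lemma 5.3
  (`DeltaFar.norm_DeltaW_le_of_far`: `‖Δ(x)‖ ≤ e^{−c𝓛¹⁰}x⁻⁶` for `|x − t₀| ≥ (3/5)t₀`), which
  applies since `T²/2 ≥ (8/5)t₀` for `D` large — the same route as the landed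
  `Section7TruncI.step7bTruncI_holds`, with the far-ness coming from `l > P²` instead of
  `l ∉ 𝔌(Rh)`.
* `frakS_le_powX` — arbitrary power saving `‖𝔰(r,h,d;θ)‖ ≤ 2τ₅(d)·hr·P²·D^{−A}` for `1 < r < D`,
  `θ` primitive, on the extended range: the `l ≤ P²` head by the repaired per-term bound
  `Skeleton.step7u033_repaired` (whose hypotheses are already range-free), the tail by
  `tail7P2X_le` — the extended-range counterpart of the landed `frakS_le_pow`.

Theorems only; 0 new definitions; 0 new facts. The aggregation of these bounds over the extended
triple range, the dyadic `r ≥ D` leg and the (7.12)→(7.13) insertion are follow-up files of the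
same rung (GAP-LEDGER G-adj2-1 discharge lane).

WHAT THIS IS NOT: any claim about Theorems 1–2 of the manuscript or about Landau–Siegel zeros;
not a proof of (7.11) or (7.13); no change to the G-adj2-1 row (its as-printed range question
stays settled as "not derivable as printed").

## References

* Y. Zhang, arXiv:2211.02515v1 (2022), §7 pp. 37–39, (7.2), (7.13)–(7.15), tex L1813–L2030;
  §5 Lemmas 5.3–5.4. [cite: Zhang2022LandauSiegel, §7 pp. 37–39]
-/

noncomputable section

open Complex Real Finset

namespace Literature.NumberTheory.LFunctions.Zhang2022.Section7cStatements

open Literature.NumberTheory.LFunctions.Zhang2022.Skeleton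

open scoped Classical

/-! ## Elementary helpers (local copies of private lemmas of the lane, unchanged) -/

/-- `τ_j(mn) ≤ τ_j(m)τ_j(n)` (local copy of the lane's submultiplicativity). [folklore] -/
private theorem tau_mul_le' (j m n : ℕ) :
    MeanSquareMajorant.tau j (m * n) ≤ MeanSquareMajorant.tau j m * MeanSquareMajorant.tau j n := by
  induction j generalizing m n with
  | zero =>
    simp only [MeanSquareMajorant.tau_zero, ArithmeticFunction.one_apply, mul_eq_one]
    by_cases hm : m = 1
    · by_cases hn : n = 1
      · simp [hm, hn]
      · simp [hm, hn]
    · simp [hm]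
  | succ j ih =>
    rcases Nat.eq_zero_or_pos m with rfl | hm
    · simp only [zero_mul, ArithmeticFunction.map_zero]
      exact le_of_eq (by ring)
    rcases Nat.eq_zero_or_pos n with rfl | hn
    · simp only [mul_zero, ArithmeticFunction.map_zero]
      exact le_of_eq (by ring)
    rw [MeanSquareMajorant.tau_succ_apply, MeanSquareMajorant.tau_succ_apply,
      MeanSquareMajorant.tau_succ_apply, Finset.sum_mul_sum, ← Finset.sum_product']
    have hsub : (m * n).divisors ⊆ (m.divisors ×ˢ n.divisors).image (fun x => x.1 * x.2) := by
      intro e he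
      have hd := Nat.dvd_of_mem_divisors he
      obtain ⟨e₁, e₂, h₁, h₂, rfl⟩ := Nat.dvd_mul.mp hd
      exact Finset.mem_image.mpr ⟨(e₁, e₂), Finset.mem_product.mpr
        ⟨Nat.mem_divisors.mpr ⟨h₁, hm.ne'⟩, Nat.mem_divisors.mpr ⟨h₂, hn.ne'⟩⟩, rfl⟩
    calc ∑ e ∈ (m * n).divisors, MeanSquareMajorant.tau j e
        ≤ ∑ e ∈ (m.divisors ×ˢ n.divisors).image (fun x => x.1 * x.2), MeanSquareMajorant.tau j e :=
          Finset.sum_le_sum_of_subset_of_nonneg hsub fun _ _ _ => MeanSquareMajorant.tau_nonneg _ _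
      _ ≤ ∑ x ∈ m.divisors ×ˢ n.divisors, MeanSquareMajorant.tau j (x.1 * x.2) :=
          Finset.sum_image_le_of_nonneg fun _ _ => MeanSquareMajorant.tau_nonneg _ _
      _ ≤ ∑ x ∈ m.divisors ×ˢ n.divisors,
            MeanSquareMajorant.tau j x.1 * MeanSquareMajorant.tau j x.2 :=
          Finset.sum_le_sum fun x _ => ih x.1 x.2

/-- `1 ≤ τ₅(l)` for `l ≥ 1` (local copy). [folklore] -/
private theorem one_le_tau_five {l : ℕ} (hl : l ≠ 0) : 1 ≤ MeanSquareMajorant.tau 5 l := by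
  have key : ∀ j : ℕ, 1 ≤ MeanSquareMajorant.tau (j + 1) l := by
    intro j
    induction j with
    | zero => rw [MeanSquareMajorant.tau_one_apply hl]
    | succ j ih =>
      rw [MeanSquareMajorant.tau_succ_apply]
      calc (1 : ℝ) ≤ MeanSquareMajorant.tau (j + 1) l := ih
        _ ≤ ∑ e ∈ l.divisors, MeanSquareMajorant.tau (j + 1) e :=
          Finset.single_le_sum (f := fun e => MeanSquareMajorant.tau (j + 1) e)
            (fun e _ => MeanSquareMajorant.tau_nonneg (j + 1) e) (Nat.mem_divisors_self l hl)
  exact key 4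

/-- Domination of a Dirichlet product from dominations of the factors (local copy). [folklore] -/
private theorem dom_mul' {f g : ArithmeticFunction ℂ} {C₁ C₂ : ℝ} {g₁ g₂ : ArithmeticFunction ℝ}
    (hf : MeanSquareMajorant.Dom (fun n => f n) C₁ g₁)
    (hg : MeanSquareMajorant.Dom (fun n => g n) C₂ g₂) :
    MeanSquareMajorant.Dom (fun n => (f * g) n) (C₁ * C₂) (g₁ * g₂) := by
  intro n hn
  have h := MeanSquareMajorant.dom_seqConv hf hg n hn
  rw [ArithmeticFunction.mul_apply]
  exact h

/-- `|κ(n)| ≤ τ₄(n)` for `n ≥ 1` (local copy). [folklore] -/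
private theorem norm_kappaZ_le4 (c' : ℝ) (D : ℕ) {n : ℕ} (hn : n ≠ 0) :
    ‖Skeleton.kappaZ c' D n‖ ≤ MeanSquareMajorant.tau 4 n := by
  have hI : ∀ b : ℝ, MeanSquareMajorant.Dom (fun n => MeanSquareMajorant.powI b n) 1
      (MeanSquareMajorant.tau 1) := fun b =>
    MeanSquareMajorant.dom_tau_one fun n hn =>
      (MeanSquareMajorant.norm_powI_of_pos b (Nat.pos_of_ne_zero hn)).le
  have hμ : MeanSquareMajorant.Dom
      (fun n => (ArithmeticFunction.moebius : ArithmeticFunction ℂ) n) 1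
      (MeanSquareMajorant.tau 1) :=
    MeanSquareMajorant.dom_tau_one fun n _ => norm_moebius_complex_le_one n
  have h := dom_mul' (dom_mul' (dom_mul' (hI (Skeleton.b1 c' D)) (hI (Skeleton.b2 c' D)))
    (hI (Skeleton.b3 c' D))) hμ
  have h' := h n hn
  have htau : MeanSquareMajorant.tau 1 * MeanSquareMajorant.tau 1 * MeanSquareMajorant.tau 1 *
      MeanSquareMajorant.tau 1 = MeanSquareMajorant.tau 4 := by
    simp only [MeanSquareMajorant.tau]; ring
  rw [htau] at h'
  unfold Skeleton.kappaZ MeanSquareMajorant.kappa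
  simpa only [one_mul] using h'

/-- `|(κ∗a)(m)| ≤ B·τ₅(m)` for `|a| ≤ B` (local copy). [folklore] -/
private theorem norm_conv_kappaZ_le' (c' : ℝ) (D : ℕ) {a : ℕ → ℂ} {B : ℝ} (ha : ∀ n, ‖a n‖ ≤ B)
    (m : ℕ) :
    ‖MeanSquareMajorant.conv (Skeleton.kappaZ c' D) a m‖ ≤ B * MeanSquareMajorant.tau 5 m := by
  rcases Nat.eq_zero_or_pos m with rfl | hm
  · simp [MeanSquareMajorant.conv]
  have hκ : MeanSquareMajorant.Dom (fun n => Skeleton.kappaZ c' D n) 1 (MeanSquareMajorant.tau 4) :=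
    fun n hn => by rw [one_mul]; exact norm_kappaZ_le4 c' D hn
  have haD : MeanSquareMajorant.Dom a B (MeanSquareMajorant.tau 1) :=
    MeanSquareMajorant.dom_tau_one fun n _ => ha n
  have h := MeanSquareMajorant.dom_seqConv hκ haD m hm.ne'
  have htau : MeanSquareMajorant.tau 4 * MeanSquareMajorant.tau 1 = MeanSquareMajorant.tau 5 := by
    simp only [MeanSquareMajorant.tau]; ring
  rw [htau, one_mul] at h
  exact h

/-- `log D ≥ 1` once `D ≥ 3` (local copy). [folklore] -/
private theorem one_le_ell' {D : ℕ} (hD : 3 ≤ D) : 1 ≤ Skeleton.ell D := by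
  have hD' : (3 : ℝ) ≤ D := by exact_mod_cast hD
  rw [Skeleton.ell, Real.le_log_iff_exp_le (by linarith)]
  exact le_trans (le_of_lt (lt_trans Real.exp_one_lt_d9 (by norm_num))) hD'

/-- `1 ≤ P` (local copy). [folklore] -/
private theorem one_le_bigP' (D : ℕ) : 1 ≤ Skeleton.bigP D :=
  Real.one_le_exp (by rw [Skeleton.ell]; positivity)

/-- `Re β₃ = 0` (local copy: `β₃ = 3iα(1 − c′α𝓛)` (2.13)).
[cite: Zhang2022LandauSiegel, §2 (2.13)] -/
private theorem beta3_re' (c' : ℝ) (D : ℕ) : (Skeleton.beta3 c' D).re = 0 := by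
  rw [beta3_eq_mul_I, Complex.re_ofReal_mul, Complex.I_re, mul_zero]

/-! ## The window geometry of the extended range: `T²/2` is far from `t₀` -/

/-- For `D` large, `(16/5)·t₀ ≤ T²` (`t₀ = 𝓛⁵¹⁹`, `T = exp(𝓛^{1.1})`): polynomial against
stretched-exponential. [cite: Zhang2022LandauSiegel, §2 (2.8), §5 tex L1689] -/
private theorem t0_le_bigT_sq : ∃ D₀ : ℕ, ∀ D : ℕ, D₀ ≤ D → 3 ≤ D →
    16 / 5 * Skeleton.t0 D ≤ Skeleton.bigT D ^ 2 := by
  obtain ⟨D₀, hD₀⟩ := Skeleton.exists_nat_forall_le_ell ((261 : ℝ) ^ (10 : ℕ))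
  refine ⟨D₀, fun D hD hD3 => ?_⟩
  have hM := hD₀ D hD
  have hℓ1 : 1 ≤ Skeleton.ell D := one_le_ell' hD3
  have hℓ0 : 0 < Skeleton.ell D := by linarith
  set L := Skeleton.ell D with hL
  -- `261 ≤ L^{0.1}`
  have h261 : (261 : ℝ) ≤ L ^ (0.1 : ℝ) := by
    have h1 : ((261 : ℝ) ^ (10 : ℕ)) ^ (0.1 : ℝ) ≤ L ^ (0.1 : ℝ) :=
      Real.rpow_le_rpow (by positivity) hM (by norm_num)
    have h2 : ((261 : ℝ) ^ (10 : ℕ)) ^ (0.1 : ℝ) = 261 := by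
      rw [← Real.rpow_natCast (261 : ℝ) 10, ← Real.rpow_mul (by norm_num)]
      norm_num
    linarith
  -- `L^{1.1} = L·L^{0.1}`
  have hsplit : L ^ (1.1 : ℝ) = L * L ^ (0.1 : ℝ) := by
    rw [show (1.1 : ℝ) = 1 + 0.1 by norm_num, Real.rpow_add hℓ0, Real.rpow_one]
  -- `t₀ = L^{519} ≤ exp(519·L)`
  have ht0 : Skeleton.t0 D ≤ Real.exp (519 * L) := by
    have hxe : L ≤ Real.exp L := by
      have := Real.add_one_le_exp L
      linarith
    calc Skeleton.t0 D = L ^ (519 : ℕ) := rfl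
      _ ≤ (Real.exp L) ^ (519 : ℕ) := pow_le_pow_left₀ (by linarith) hxe 519
      _ = Real.exp ((519 : ℕ) * L) := by rw [← Real.exp_nat_mul]
      _ = Real.exp (519 * L) := by norm_num
  -- `16/5 ≤ exp 2`
  have h165 : (16 / 5 : ℝ) ≤ Real.exp 2 := by
    have h1 : (2.7 : ℝ) ≤ Real.exp 1 := by
      have := Real.exp_one_gt_d9; linarith
    have h2 : (2.7 : ℝ) * 2.7 ≤ Real.exp 1 * Real.exp 1 :=
      mul_le_mul h1 h1 (by norm_num) (Real.exp_nonneg 1)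
    calc (16 / 5 : ℝ) ≤ 2.7 * 2.7 := by norm_num
      _ ≤ Real.exp 1 * Real.exp 1 := h2
      _ = Real.exp 2 := by rw [← Real.exp_add]; norm_num
  -- assemble: `2 + 519L ≤ 2L^{1.1}`
  have hexp : 2 + 519 * L ≤ 2 * L ^ (1.1 : ℝ) := by
    have h1 : 2 * L ^ (1.1 : ℝ) = 2 * L * L ^ (0.1 : ℝ) := by rw [hsplit]; ring
    have h2 : 2 * L * 261 ≤ 2 * L * L ^ (0.1 : ℝ) :=
      mul_le_mul_of_nonneg_left h261 (by linarith)
    nlinarith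
  have hT2 : Skeleton.bigT D ^ 2 = Real.exp (2 * L ^ (1.1 : ℝ)) := by
    rw [Skeleton.bigT, sq, ← Real.exp_add, ← hL]; ring_nf
  have ht0nn : 0 ≤ Skeleton.t0 D := pow_nonneg hℓ0.le 519
  calc 16 / 5 * Skeleton.t0 D ≤ Real.exp 2 * Real.exp (519 * L) :=
        mul_le_mul h165 ht0 ht0nn (Real.exp_nonneg 2)
    _ = Real.exp (2 + 519 * L) := by rw [← Real.exp_add]
    _ ≤ Real.exp (2 * L ^ (1.1 : ℝ)) := Real.exp_le_exp.2 hexp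
    _ = Skeleton.bigT D ^ 2 := hT2.symm

/-! ## The `l > P²` tail on the extended range -/

set_option maxHeartbeats 800000 in
/-- **The `l > P²` tail of `𝔰(r,h,d;θ)` on the extended (7.2)-support range.** There is `c > 0`
such that for all large `D` under (A), every `𝐚₁` with (7.2), all `d, h, r ≥ 1` and every
`θ (mod r)` with `hr ≤ PT⁻²` and `d ≤ P`: `‖tail7P2‖ ≤ exp(−c𝓛¹⁰)`. Unlike the printed-range
tail (`Section7TailP2.step7bTruncP2_holds`, `x = l/(phr) ≥ P^{0.496}/2`, Lemma 5.3 (ii)), here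
only `x ≥ T²/2` is available; since `T²/2 ≥ (8/5)t₀` for `D` large, every tail point lies in the
FAR region of Lemma 5.3, where `‖Δ(x)‖ ≤ e^{−c₀𝓛¹⁰}x⁻⁶` (`DeltaFar.norm_DeltaW_le_of_far`), and
the `x⁻⁶`-decay gives an `l⁻²`-summable majorant exactly as in the landed
`Section7TruncI.step7bTruncI_holds`. [cite: Zhang2022LandauSiegel, §7 p.38 tex L2008; §5 Lemma 5.3] -/
theorem tail7P2X_le (c' : ℝ) (B : ℝ) :
    ∃ c : ℝ, 0 < c ∧ Skeleton.ForAllLarge fun D _ χ => Skeleton.AssumptionA D χ →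
      ∀ a₁ : ℕ → ℂ, Skeleton.Adm72 D B a₁ →
        ∀ (d h r : ℕ) (θ : DirichletCharacter ℂ r), 0 < d → 0 < h → 0 < r →
          ((h * r : ℕ) : ℝ) ≤ Skeleton.bigP D / Skeleton.bigT D ^ 2 →
          ((d : ℕ) : ℝ) ≤ Skeleton.bigP D →
            ‖tail7P2 c' D a₁ r h d θ‖ ≤ Real.exp (-c * Skeleton.ell D ^ 10) := by
  classical
  obtain ⟨c₀, hc₀, D₁, hfar⟩ := DeltaFar.norm_DeltaW_le_of_far
  have hZsum : Summable (fun l : ℕ => ((l : ℝ) ^ 2)⁻¹) :=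
    Real.summable_nat_pow_inv.mpr one_lt_two
  set Z : ℝ := ∑' l : ℕ, ((l : ℝ) ^ 2)⁻¹ with hZ
  have hZ0 : 0 ≤ Z := tsum_nonneg fun l => by positivity
  set B₀ : ℝ := max B 0 with hB₀
  have hB₀0 : 0 ≤ B₀ := le_max_right _ _
  have hBB₀ : B ≤ B₀ := le_max_left _ _
  set K : ℝ := 12288 * B₀ * Z with hK
  have hK0 : 0 ≤ K := by positivity
  set M : ℝ := max 2 (2 / c₀ * (17 + Real.log (K + 1))) with hM
  obtain ⟨D₂, hD₂⟩ := Skeleton.exists_nat_forall_le_ell M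
  obtain ⟨D₃, hD₃⟩ := t0_le_bigT_sq
  refine ⟨c₀ / 2, by positivity, max D₁ (max D₂ (max D₃ 3)), ?_⟩
  intro D _ χ hD hq hprim _hA a₁ ha d h r θ hd hh hr hhrT hdP
  have hD₁ : D₁ ≤ D := le_trans (le_max_left _ _) hD
  have hD₂' : D₂ ≤ D := le_trans ((le_max_left _ _).trans (le_max_right _ _)) hD
  have hD₃' : D₃ ≤ D :=
    le_trans (((le_max_left _ _).trans (le_max_right _ _)).trans (le_max_right _ _)) hD
  have hD3 : 3 ≤ D :=
    le_trans (((le_max_right _ _).trans (le_max_right _ _)).trans (le_max_right _ _)) hD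
  have hMℓ : M ≤ Skeleton.ell D := hD₂ D hD₂'
  have hℓ2 : 2 ≤ Skeleton.ell D := le_trans (le_max_left _ _) hMℓ
  have hℓM : 2 / c₀ * (17 + Real.log (K + 1)) ≤ Skeleton.ell D := le_trans (le_max_right _ _) hMℓ
  have hℓ1 : 1 ≤ Skeleton.ell D := by linarith
  have hℓ0 : 0 < Skeleton.ell D := by linarith
  have hfarD := hfar D χ hD₁ hq hprim
  obtain ⟨ha1, -⟩ := ha
  have hB0 : 0 ≤ B := (norm_nonneg _).trans (ha1 0)
  have ht0T := hD₃ D hD₃' hD3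
  -- sizes
  have hP : 0 < bigP D := bigP_pos D
  have hP1 : 1 ≤ bigP D := one_le_bigP' D
  have hT1 : 1 ≤ Skeleton.bigT D :=
    Real.one_le_exp (Real.rpow_nonneg (le_of_lt hℓ0) _)
  have hT21 : 1 ≤ Skeleton.bigT D ^ 2 := one_le_pow₀ hT1
  have hT20 : 0 < Skeleton.bigT D ^ 2 := by positivity
  have ht00 : 0 < t0 D := by rw [t0]; exact pow_pos hℓ0 519
  have hh0 : (0 : ℝ) < h := Nat.cast_pos.mpr hh
  have hr0 : (0 : ℝ) < r := Nat.cast_pos.mpr hr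
  have hd0 : (0 : ℝ) < d := Nat.cast_pos.mpr hd
  have hhr0 : (0 : ℝ) < ((h * r : ℕ) : ℝ) := by exact_mod_cast Nat.mul_pos hh hr
  -- the cap `W` for `phr`, and its size
  set ε : ℝ := Real.exp (-c₀ * Skeleton.ell D ^ 10) with hε
  have hε0 : 0 < ε := Real.exp_pos _
  set W : ℝ := 2 * bigP D * ((h * r : ℕ) : ℝ) with hW
  have hW0 : 0 < W := by positivity
  have hWT : W ≤ 2 * bigP D ^ 2 / Skeleton.bigT D ^ 2 := by
    have h1 : 2 * bigP D * ((h * r : ℕ) : ℝ) ≤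
        2 * bigP D * (bigP D / Skeleton.bigT D ^ 2) := by
      apply mul_le_mul_of_nonneg_left hhrT (by positivity)
    calc W = 2 * bigP D * ((h * r : ℕ) : ℝ) := rfl
      _ ≤ 2 * bigP D * (bigP D / Skeleton.bigT D ^ 2) := h1
      _ = 2 * bigP D ^ 2 / Skeleton.bigT D ^ 2 := by ring
  have hW_le : W ≤ 2 * bigP D ^ 2 := by
    have h1 : 2 * bigP D ^ 2 / Skeleton.bigT D ^ 2 ≤ 2 * bigP D ^ 2 :=
      div_le_self (by positivity) hT21
    exact hWT.trans h1
  -- the bottom of the tail is far from `t₀`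
  have hbot : Skeleton.bigT D ^ 2 / 2 ≤ bigP D ^ 2 / W := by
    rw [div_le_div_iff₀ (by norm_num) hW0]
    have h1 : Skeleton.bigT D ^ 2 * W ≤
        Skeleton.bigT D ^ 2 * (2 * bigP D ^ 2 / Skeleton.bigT D ^ 2) := by
      apply mul_le_mul_of_nonneg_left hWT (by positivity)
    have h2 : Skeleton.bigT D ^ 2 * (2 * bigP D ^ 2 / Skeleton.bigT D ^ 2) =
        2 * bigP D ^ 2 := by
      field_simp
    nlinarith [h1, h2]
  set A : ℝ := B * (d : ℝ) ^ 4 * (3 * bigP D) * W ^ 6 * ε with hA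
  have hA0 : 0 ≤ A :=
    mul_nonneg (mul_nonneg (mul_nonneg (mul_nonneg hB0 (pow_nonneg hd0.le 4)) (by positivity))
      (pow_nonneg hW0.le 6)) hε0.le
  -- the termwise bound
  have hgsum : Summable (fun l : ℕ => A * ((l : ℝ) ^ 2)⁻¹) := hZsum.mul_left A
  have e : tail7P2 c' D a₁ r h d θ = ∑' l : ℕ,
      (if bigP D ^ 2 < (l : ℝ) ∧ Nat.Coprime l h then
        MeanSquareMajorant.conv (Skeleton.kappaZ c' D) a₁ (d * l) * θ (l : ZMod r) *
          ∑ p ∈ Skeleton.primeWindow D, (p : ℂ) ^ Skeleton.beta3 c' D * θ⁻¹ (p : ZMod r) *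
            Skeleton.DeltaW D ((l : ℝ) / ((p : ℝ) * h * r))
      else 0) := rfl
  have hbound : ∀ l : ℕ,
      ‖(if bigP D ^ 2 < (l : ℝ) ∧ Nat.Coprime l h then
        MeanSquareMajorant.conv (Skeleton.kappaZ c' D) a₁ (d * l) * θ (l : ZMod r) *
          ∑ p ∈ Skeleton.primeWindow D, (p : ℂ) ^ Skeleton.beta3 c' D * θ⁻¹ (p : ZMod r) *
            Skeleton.DeltaW D ((l : ℝ) / ((p : ℝ) * h * r))
      else 0)‖ ≤ A * ((l : ℝ) ^ 2)⁻¹ := by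
    intro l
    split_ifs with hcond
    swap
    · rw [norm_zero]; positivity
    obtain ⟨hlP, -⟩ := hcond
    have hl : 0 < l := by
      rcases Nat.eq_zero_or_pos l with rfl | h
      · exfalso
        simp only [Nat.cast_zero] at hlP
        exact absurd hlP (not_lt.2 (by positivity))
      · exact h
    have hl0 : (0 : ℝ) < l := Nat.cast_pos.mpr hl
    -- the coefficient
    have hconv : ‖MeanSquareMajorant.conv (Skeleton.kappaZ c' D) a₁ (d * l)‖ ≤
        B * ((d * l : ℕ) : ℝ) ^ 4 :=
      (Section7TailP2.norm_conv_kappa_le c' D ha1 (d * l)).trans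
        (mul_le_mul_of_nonneg_left (pow_le_pow_left₀ (Nat.cast_nonneg _)
          (by exact_mod_cast Nat.card_divisors_le_self (d * l)) 4) hB0)
    -- the `p`-sum, via the far bound
    have hinner : ‖∑ p ∈ Skeleton.primeWindow D, (p : ℂ) ^ Skeleton.beta3 c' D *
        θ⁻¹ (p : ZMod r) * Skeleton.DeltaW D ((l : ℝ) / ((p : ℝ) * h * r))‖ ≤
        3 * bigP D * (ε * (W / l) ^ 6) := by
      calc ‖∑ p ∈ Skeleton.primeWindow D, (p : ℂ) ^ Skeleton.beta3 c' D * θ⁻¹ (p : ZMod r) *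
              Skeleton.DeltaW D ((l : ℝ) / ((p : ℝ) * h * r))‖
          ≤ ∑ p ∈ Skeleton.primeWindow D, ‖(p : ℂ) ^ Skeleton.beta3 c' D * θ⁻¹ (p : ZMod r) *
              Skeleton.DeltaW D ((l : ℝ) / ((p : ℝ) * h * r))‖ := norm_sum_le _ _
        _ ≤ ∑ p ∈ Skeleton.primeWindow D, ε * (W / l) ^ 6 := by
            refine Finset.sum_le_sum fun p hp => ?_
            have hp0 : (0 : ℝ) < p := pos_of_mem_primeWindow hp
            have hQ0 : 0 < (p : ℝ) * h * r := by positivity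
            have hx0 : 0 < (l : ℝ) / ((p : ℝ) * h * r) := div_pos hl0 hQ0
            have hQW : (p : ℝ) * h * r ≤ W := by
              have hp2 : (p : ℝ) ≤ 2 * bigP D := le_two_mul_bigP_of_mem_primeWindow hℓ1 hp
              have hcast : ((h * r : ℕ) : ℝ) = (h : ℝ) * r := by push_cast; ring
              calc (p : ℝ) * h * r ≤ 2 * bigP D * h * r := by
                    apply mul_le_mul_of_nonneg_right _ hr0.le
                    exact mul_le_mul_of_nonneg_right hp2 hh0.le
                _ = W := by rw [hW, hcast]; ring
            -- far from `t₀`: `x ≥ l/W > P²/W ≥ T²/2 ≥ (8/5)t₀`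
            have hxW : (l : ℝ) / W ≤ (l : ℝ) / ((p : ℝ) * h * r) := by gcongr
            have hPl : bigP D ^ 2 / W ≤ (l : ℝ) / W := by gcongr
            have hfar85 : 8 / 5 * t0 D ≤ (l : ℝ) / ((p : ℝ) * h * r) := by
              have h85 : 8 / 5 * t0 D ≤ Skeleton.bigT D ^ 2 / 2 := by linarith
              linarith
            have hfarx : 3 / 5 * t0 D ≤ |(l : ℝ) / ((p : ℝ) * h * r) - t0 D| := by
              have hxt : t0 D ≤ (l : ℝ) / ((p : ℝ) * h * r) := by linarith
              rw [abs_of_nonneg (by linarith)]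
              linarith
            have hΔ := hfarD ((l : ℝ) / ((p : ℝ) * h * r)) hx0 hfarx
            have hx6 : ((((l : ℝ) / ((p : ℝ) * h * r)) ^ 6)⁻¹) ≤ (W / l) ^ 6 := by
              rw [← inv_pow, inv_div]
              exact pow_le_pow_left₀ (div_nonneg hQ0.le hl0.le)
                (div_le_div_of_nonneg_right hQW hl0.le) 6
            rw [norm_mul, norm_mul,
              Complex.norm_natCast_cpow_of_pos (prime_of_mem_primeWindow' hp).pos, beta3_re',
              Real.rpow_zero, one_mul]
            calc ‖θ⁻¹ (p : ZMod r)‖ * ‖Skeleton.DeltaW D ((l : ℝ) / ((p : ℝ) * h * r))‖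
                ≤ 1 * (ε * ((((l : ℝ) / ((p : ℝ) * h * r)) ^ 6)⁻¹)) :=
                  mul_le_mul (DirichletCharacter.norm_le_one _ _) hΔ (norm_nonneg _) zero_le_one
              _ ≤ ε * (W / l) ^ 6 := by
                  rw [one_mul]; exact mul_le_mul_of_nonneg_left hx6 hε0.le
        _ = ((Skeleton.primeWindow D).card : ℝ) * (ε * (W / l) ^ 6) := by
            rw [Finset.sum_const, nsmul_eq_mul]
        _ ≤ 3 * bigP D * (ε * (W / l) ^ 6) :=
            mul_le_mul_of_nonneg_right (Section7TailP2.card_primeWindow_le hℓ1) (by positivity)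
    have hBdl : 0 ≤ B * ((d * l : ℕ) : ℝ) ^ 4 := mul_nonneg hB0 (pow_nonneg (Nat.cast_nonneg _) 4)
    calc ‖MeanSquareMajorant.conv (Skeleton.kappaZ c' D) a₁ (d * l) * θ (l : ZMod r) *
            ∑ p ∈ Skeleton.primeWindow D, (p : ℂ) ^ Skeleton.beta3 c' D * θ⁻¹ (p : ZMod r) *
              Skeleton.DeltaW D ((l : ℝ) / ((p : ℝ) * h * r))‖
        = ‖MeanSquareMajorant.conv (Skeleton.kappaZ c' D) a₁ (d * l)‖ * ‖θ (l : ZMod r)‖ *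
            ‖∑ p ∈ Skeleton.primeWindow D, (p : ℂ) ^ Skeleton.beta3 c' D * θ⁻¹ (p : ZMod r) *
              Skeleton.DeltaW D ((l : ℝ) / ((p : ℝ) * h * r))‖ := by rw [norm_mul, norm_mul]
      _ ≤ B * ((d * l : ℕ) : ℝ) ^ 4 * 1 * (3 * bigP D * (ε * (W / l) ^ 6)) :=
          mul_le_mul (mul_le_mul hconv (DirichletCharacter.norm_le_one _ _) (norm_nonneg _) hBdl)
            hinner (norm_nonneg _) (by rw [mul_one]; exact hBdl)
      _ = A * ((l : ℝ) ^ 2)⁻¹ := by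
          rw [hA]
          have hl0' : (l : ℝ) ≠ 0 := hl0.ne'
          push_cast
          field_simp
          try ring
  -- sum the majorant and absorb the constants
  rw [e]
  refine (tsum_of_norm_bounded hgsum.hasSum hbound).trans ?_
  rw [tsum_mul_left, ← hZ]
  have hA_le : A ≤ 12288 * B₀ * bigP D ^ 17 * ε := by
    have h1 : (d : ℝ) ^ 4 ≤ bigP D ^ 4 := pow_le_pow_left₀ hd0.le hdP 4
    have h2 : W ^ 6 ≤ (2 * bigP D ^ 2) ^ 6 := pow_le_pow_left₀ hW0.le hW_le 6
    have h3 : B * (d : ℝ) ^ 4 ≤ B₀ * bigP D ^ 4 :=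
      mul_le_mul hBB₀ h1 (by positivity) hB₀0
    have h4 : (2 * bigP D ^ 2) ^ 6 = 64 * bigP D ^ 12 := by ring
    calc A = B * (d : ℝ) ^ 4 * (3 * bigP D) * W ^ 6 * ε := rfl
      _ ≤ B₀ * bigP D ^ 4 * (3 * bigP D) * (2 * bigP D ^ 2) ^ 6 * ε := by
          apply mul_le_mul_of_nonneg_right _ hε0.le
          exact mul_le_mul (mul_le_mul_of_nonneg_right h3 (by positivity)) h2
            (pow_nonneg hW0.le 6) (by positivity)
      _ = 192 * B₀ * bigP D ^ 17 * ε := by rw [h4]; ring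
      _ ≤ 12288 * B₀ * bigP D ^ 17 * ε := by
          have hb : 0 ≤ B₀ * bigP D ^ 17 * ε := by positivity
          nlinarith [hb]
  have hP17 : bigP D ^ 17 = Real.exp (17 * Skeleton.ell D ^ 9) := by
    rw [bigP, ← Real.exp_nat_mul]; norm_num
  have hK1 : 0 < K + 1 := by linarith
  have hKexp : K ≤ Real.exp (Real.log (K + 1)) := by
    rw [Real.exp_log hK1]; linarith
  have hlogK : 0 ≤ Real.log (K + 1) := Real.log_nonneg (by linarith)
  have hℓ9 : 1 ≤ Skeleton.ell D ^ 9 := one_le_pow₀ hℓ1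
  have h1 : 17 + Real.log (K + 1) ≤ c₀ / 2 * Skeleton.ell D := by
    have h := mul_le_mul_of_nonneg_left hℓM (by positivity : (0 : ℝ) ≤ c₀ / 2)
    have e2 : c₀ / 2 * (2 / c₀ * (17 + Real.log (K + 1))) = 17 + Real.log (K + 1) := by
      field_simp
    linarith [e2]
  have h2 : Real.log (K + 1) + 17 * Skeleton.ell D ^ 9 ≤ c₀ / 2 * Skeleton.ell D ^ 10 := by
    calc Real.log (K + 1) + 17 * Skeleton.ell D ^ 9 ≤
          (17 + Real.log (K + 1)) * Skeleton.ell D ^ 9 := by nlinarith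
      _ ≤ c₀ / 2 * Skeleton.ell D * Skeleton.ell D ^ 9 :=
          mul_le_mul_of_nonneg_right h1 (by positivity)
      _ = c₀ / 2 * Skeleton.ell D ^ 10 := by ring
  calc A * Z ≤ 12288 * B₀ * bigP D ^ 17 * ε * Z := mul_le_mul_of_nonneg_right hA_le hZ0
    _ = K * bigP D ^ 17 * ε := by rw [hK]; ring
    _ ≤ Real.exp (Real.log (K + 1)) * bigP D ^ 17 * ε := by
        apply mul_le_mul_of_nonneg_right _ hε0.le
        exact mul_le_mul_of_nonneg_right hKexp (by positivity)
    _ = Real.exp (Real.log (K + 1) + 17 * Skeleton.ell D ^ 9 + -c₀ * Skeleton.ell D ^ 10) := by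
        rw [hP17, hε, Real.exp_add, Real.exp_add]
    _ ≤ Real.exp (-(c₀ / 2) * Skeleton.ell D ^ 10) := Real.exp_le_exp.mpr (by linarith)

/-! ## `𝔰(r,h,d;θ)` with an arbitrary power saving, extended range -/

set_option maxHeartbeats 800000 in
/-- **Arbitrary power saving for `𝔰(r,h,d;θ)` on `1 < r < D`, extended (7.2)-support range.**
For every `A` and `B`, for all large `D` with (A), every `a₁` with (7.2), all `d, h ≥ 1`,
`1 < r < D`, `θ` primitive `(mod r)` with `hr ≤ PT⁻²`, `d ≤ P`:
`‖𝔰(r,h,d;θ)‖ ≤ 2·τ₅(d)·hr·P²·D^{−A}`. Same split as the landed `frakS_le_pow` (whose triple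
range `dhr < P₁` is NOT assumed here): head `l ≤ P²` by `Skeleton.step7u033_repaired`
(range-free), tail by `tail7P2X_le` (the far-region route).
[cite: Zhang2022LandauSiegel, §7 pp. 37–38, tex L2008–L2022] -/
theorem frakS_le_powX (c' : ℝ) (A : ℕ) (B : ℝ) :
    Skeleton.ForAllLarge fun D _ χ => Skeleton.AssumptionA D χ →
      ∀ a₁ : ℕ → ℂ, Skeleton.Adm72 D B a₁ →
        ∀ (d h r : ℕ) (θ : DirichletCharacter ℂ r), 0 < d → 0 < h → 1 < r → r < D →
          θ.IsPrimitive →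
          ((h * r : ℕ) : ℝ) ≤ Skeleton.bigP D / Skeleton.bigT D ^ 2 →
          ((d : ℕ) : ℝ) ≤ Skeleton.bigP D →
            ‖frakS c' D a₁ r h d θ‖ ≤
              2 * MeanSquareMajorant.tau 5 d * ((h * r : ℕ) : ℝ) * Skeleton.bigP D ^ 2 *
                (D : ℝ) ^ (-(A : ℝ)) := by
  classical
  obtain ⟨cT, hcT, DT, hTail⟩ := tail7P2X_le c' B
  obtain ⟨CR, DR, hRep⟩ := Skeleton.step7u033_repaired c' (A + 1)
  set K := MeanSquareMajorant.majorantConst 5 5 with hK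
  have hK0 : 0 < K := MeanSquareMajorant.majorantConst_pos _ _
  obtain ⟨Dabs, habs⟩ := Skeleton.exists_mul_ell_pow_le 45
    (show (0 : ℝ) ≤ max B 0 * max CR 0 * K * 3 ^ 5 by positivity)
  obtain ⟨Dtail, htail9⟩ := Skeleton.exists_nat_forall_le_ell ((A : ℝ) / cT + 1)
  refine ⟨DT + DR + Dabs + Dtail + 3, fun D _ χ hD hq hp hA a₁ ha d h r θ hd hh h1r hrD hθ
    hhrT hdP => ?_⟩
  have hDT : DT ≤ D := by omega
  have hDR : DR ≤ D := by omega
  have hDabs : Dabs ≤ D := by omega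
  have hDtail : Dtail ≤ D := by omega
  have hD3 : 3 ≤ D := by omega
  have hr : 0 < r := by omega
  -- sizes
  have hL1 : 1 ≤ Skeleton.ell D := one_le_ell' hD3
  have hP1 : 1 ≤ Skeleton.bigP D := one_le_bigP' D
  set L := Skeleton.ell D with hLdef
  set P := Skeleton.bigP D with hPdef
  set τ := MeanSquareMajorant.tau 5 d with hτdef
  have hL0 : 0 ≤ L := zero_le_one.trans hL1
  have hD0 : (0 : ℝ) < D := by exact_mod_cast (show 0 < D by omega)
  have hτ1 : 1 ≤ τ := one_le_tau_five (by omega)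
  have hτ0 : 0 ≤ τ := zero_le_one.trans hτ1
  have hhr1 : (1 : ℝ) ≤ ((h * r : ℕ) : ℝ) := by exact_mod_cast Nat.mul_pos hh hr
  -- the summands of `𝔰` and of its tail
  set S : ℕ → ℂ := fun l => ∑ p ∈ Skeleton.primeWindow D,
      (p : ℂ) ^ Skeleton.beta3 c' D * θ⁻¹ (p : ZMod r) *
        Skeleton.DeltaW D ((l : ℝ) / ((p : ℝ) * h * r)) with hSdef
  set f : ℕ → ℂ := fun l => if Nat.Coprime l h then
      MeanSquareMajorant.conv (Skeleton.kappaZ c' D) a₁ (d * l) * θ (l : ZMod r) * S l else 0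
    with hfdef
  set tl : ℕ → ℂ := fun l => if P ^ 2 < (l : ℝ) ∧ Nat.Coprime l h then
      MeanSquareMajorant.conv (Skeleton.kappaZ c' D) a₁ (d * l) * θ (l : ZMod r) * S l else 0
    with htldef
  have hfrakS : frakS c' D a₁ r h d θ = ∑' l, f l := rfl
  have htail : tail7P2 c' D a₁ r h d θ = ∑' l, tl l := rfl
  have hRHS0 : 0 ≤ 2 * τ * ((h * r : ℕ) : ℝ) * P ^ 2 * (D : ℝ) ^ (-(A : ℝ)) := by positivity
  by_cases hsum : Summable f
  swap
  · rw [hfrakS, tsum_eq_zero_of_not_summable hsum, norm_zero]; exact hRHS0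
  set N := ⌊P ^ 2⌋₊ with hNdef
  set g : ℕ → ℂ := fun l => f l - tl l with hgdef
  have hg_zero : ∀ l ∉ Finset.range (N + 1), g l = 0 := by
    intro l hl
    have hlN : N + 1 ≤ l := by simpa [Finset.mem_range, not_lt] using hl
    have hlP : P ^ 2 < (l : ℝ) := Nat.lt_of_floor_lt (by omega)
    simp only [hgdef, hfdef, htldef, hlP, true_and, sub_self]
  have hg_sum : Summable g := summable_of_ne_finset_zero hg_zero
  have htl_sum : Summable tl := by
    refine (hsum.sub hg_sum).congr fun l => ?_
    simp only [hgdef]; ring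
  have hsplit : frakS c' D a₁ r h d θ =
      ∑ l ∈ Finset.range (N + 1), g l + tail7P2 c' D a₁ r h d θ := by
    rw [hfrakS, htail]
    have e1 : ∑' l, f l = ∑' l, (g l + tl l) := tsum_congr fun l => by simp only [hgdef]; ring
    rw [e1, hg_sum.tsum_add htl_sum, tsum_eq_sum hg_zero]
  have hg_eq : ∀ l ∈ Finset.range (N + 1), g l = f l := by
    intro l hl
    have hlN : l ≤ N := by simpa [Finset.mem_range, Nat.lt_succ_iff] using hl
    have hlP : ¬ (P ^ 2 < (l : ℝ)) :=
      not_lt.2 (le_trans (by exact_mod_cast hlN) (Nat.floor_le (by positivity)))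
    simp only [hgdef, htldef, hlP, false_and, if_false, sub_zero]
  -- per-`l` bound on the head, from the REPAIRED `§7.u033`
  have hf_bound : ∀ l ∈ Finset.range (N + 1), ‖f l‖ ≤
      max B 0 * max CR 0 * τ * ((h * r : ℕ) : ℝ) * P ^ 2 * (D : ℝ) ^ (-((A : ℝ) + 1)) *
        (MeanSquareMajorant.tau 5 l / l) := by
    intro l hl
    rcases Nat.eq_zero_or_pos l with rfl | hl0
    · simp [hfdef, MeanSquareMajorant.conv]
    have hS : ‖S l‖ ≤ CR * (((h * r : ℕ) : ℝ) / l) * P ^ 2 * (D : ℝ) ^ (-((A : ℝ) + 1)) := by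
      have hh' := hRep D χ hDR hq hp hA r h l θ h1r hrD hθ hh hl0
      have hcast : (-((A + 1 : ℕ) : ℝ)) = -((A : ℝ) + 1) := by push_cast; ring
      rw [hcast] at hh'
      exact hh'
    have hS' : ‖S l‖ ≤ max CR 0 * (((h * r : ℕ) : ℝ) / l) * P ^ 2 *
        (D : ℝ) ^ (-((A : ℝ) + 1)) := by
      refine hS.trans ?_
      have hfac : (0 : ℝ) ≤ (((h * r : ℕ) : ℝ) / l) * P ^ 2 * (D : ℝ) ^ (-((A : ℝ) + 1)) := by
        positivity
      calc CR * (((h * r : ℕ) : ℝ) / l) * P ^ 2 * (D : ℝ) ^ (-((A : ℝ) + 1))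
          = CR * ((((h * r : ℕ) : ℝ) / l) * P ^ 2 * (D : ℝ) ^ (-((A : ℝ) + 1))) := by ring
        _ ≤ max CR 0 * ((((h * r : ℕ) : ℝ) / l) * P ^ 2 * (D : ℝ) ^ (-((A : ℝ) + 1))) :=
            mul_le_mul_of_nonneg_right (le_max_left _ _) hfac
        _ = max CR 0 * (((h * r : ℕ) : ℝ) / l) * P ^ 2 * (D : ℝ) ^ (-((A : ℝ) + 1)) := by ring
    have hconv : ‖MeanSquareMajorant.conv (Skeleton.kappaZ c' D) a₁ (d * l)‖ ≤
        max B 0 * (τ * MeanSquareMajorant.tau 5 l) := by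
      calc ‖MeanSquareMajorant.conv (Skeleton.kappaZ c' D) a₁ (d * l)‖
          ≤ B * MeanSquareMajorant.tau 5 (d * l) := norm_conv_kappaZ_le' c' D ha.1 (d * l)
        _ ≤ max B 0 * MeanSquareMajorant.tau 5 (d * l) :=
            mul_le_mul_of_nonneg_right (le_max_left _ _) (MeanSquareMajorant.tau_nonneg _ _)
        _ ≤ max B 0 * (τ * MeanSquareMajorant.tau 5 l) :=
            mul_le_mul_of_nonneg_left (tau_mul_le' 5 d l) (le_max_right _ _)
    have hfl : ‖f l‖ ≤ ‖MeanSquareMajorant.conv (Skeleton.kappaZ c' D) a₁ (d * l)‖ * 1 * ‖S l‖ := by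
      simp only [hfdef]
      split_ifs with hc
      · rw [norm_mul, norm_mul]
        gcongr
        exact DirichletCharacter.norm_le_one _ _
      · rw [norm_zero]; positivity
    have hτl : 0 ≤ MeanSquareMajorant.tau 5 l := MeanSquareMajorant.tau_nonneg _ _
    calc ‖f l‖ ≤ ‖MeanSquareMajorant.conv (Skeleton.kappaZ c' D) a₁ (d * l)‖ * 1 * ‖S l‖ := hfl
      _ ≤ max B 0 * (τ * MeanSquareMajorant.tau 5 l) * 1 *
            (max CR 0 * (((h * r : ℕ) : ℝ) / l) * P ^ 2 * (D : ℝ) ^ (-((A : ℝ) + 1))) :=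
          mul_le_mul (mul_le_mul_of_nonneg_right hconv zero_le_one) hS' (norm_nonneg _)
            (mul_nonneg (mul_nonneg (le_max_right _ _) (mul_nonneg hτ0 hτl)) zero_le_one)
      _ = max B 0 * max CR 0 * τ * ((h * r : ℕ) : ℝ) * P ^ 2 * (D : ℝ) ^ (-((A : ℝ) + 1)) *
            (MeanSquareMajorant.tau 5 l / l) := by ring
  -- the `τ₅/l`-sum over the head
  have hN2 : 3 ≤ N + 1 := by
    have hPe : Real.exp 1 ≤ P := by
      rw [show P = Real.exp (L ^ 9) from rfl]; exact Real.exp_le_exp.2 (one_le_pow₀ hL1)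
    have he : (2 : ℝ) < Real.exp 1 := by have := Real.exp_one_gt_d9; linarith
    have h2 : (2 : ℝ) ≤ P ^ 2 := by nlinarith
    have : 2 ≤ N := Nat.le_floor (by exact_mod_cast h2)
    omega
  have hlogN : Real.log ((N + 1 : ℕ) : ℝ) ≤ 3 * L ^ 9 := by
    have hN0 : (0 : ℝ) < ((N + 1 : ℕ) : ℝ) := by positivity
    have hNP : ((N + 1 : ℕ) : ℝ) ≤ 2 * P ^ 2 := by
      push_cast
      have h1 : (N : ℝ) ≤ P ^ 2 := Nat.floor_le (by positivity)
      have h2 : (1 : ℝ) ≤ P ^ 2 := one_le_pow₀ hP1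
      linarith
    have hlogP : Real.log P = L ^ 9 := by
      rw [show P = Real.exp (L ^ 9) from rfl, Real.log_exp]
    have hlog2 : Real.log 2 ≤ 1 := by
      have := Real.log_le_sub_one_of_pos (show (0 : ℝ) < 2 by norm_num)
      linarith
    have h19 : (1 : ℝ) ≤ L ^ 9 := one_le_pow₀ hL1
    calc Real.log ((N + 1 : ℕ) : ℝ) ≤ Real.log (2 * P ^ 2) := Real.log_le_log hN0 hNP
      _ = Real.log 2 + 2 * Real.log P := by
          rw [Real.log_mul (by norm_num) (by positivity), Real.log_pow]; push_cast; ring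
      _ ≤ 1 + 2 * L ^ 9 := by rw [hlogP]; linarith
      _ ≤ 3 * L ^ 9 := by linarith
  have htauSum : ∑ l ∈ Finset.Ico 1 (N + 1), MeanSquareMajorant.tau 5 l / l ≤
      K * 3 ^ 5 * L ^ 45 := by
    calc ∑ l ∈ Finset.Ico 1 (N + 1), MeanSquareMajorant.tau 5 l / l
        ≤ K * Real.log ((N + 1 : ℕ) : ℝ) ^ 5 := sum_Ico_tau_five_div_le hN2
      _ ≤ K * (3 * L ^ 9) ^ 5 :=
          mul_le_mul_of_nonneg_left
            (pow_le_pow_left₀ (Real.log_natCast_nonneg _) hlogN 5) (le_of_lt hK0)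
      _ = K * 3 ^ 5 * L ^ 45 := by ring
  have hcoef0 : 0 ≤ max B 0 * max CR 0 * τ * ((h * r : ℕ) : ℝ) * P ^ 2 *
      (D : ℝ) ^ (-((A : ℝ) + 1)) := by positivity
  have hsum_g : ‖∑ l ∈ Finset.range (N + 1), g l‖ ≤
      max B 0 * max CR 0 * τ * ((h * r : ℕ) : ℝ) * P ^ 2 * (D : ℝ) ^ (-((A : ℝ) + 1)) *
        (K * 3 ^ 5 * L ^ 45) := by
    have hIcc : ∑ l ∈ Finset.Ico 1 (N + 1), MeanSquareMajorant.tau 5 l / (l : ℝ) =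
        ∑ l ∈ Finset.range (N + 1), MeanSquareMajorant.tau 5 l / (l : ℝ) := by
      apply Finset.sum_subset
      · intro x hx'
        rw [Finset.mem_Ico] at hx'; rw [Finset.mem_range]; omega
      · intro x hx' hx''
        rw [Finset.mem_range] at hx'; rw [Finset.mem_Ico] at hx''
        have : x = 0 := by omega
        subst this; simp
    calc ‖∑ l ∈ Finset.range (N + 1), g l‖ ≤ ∑ l ∈ Finset.range (N + 1), ‖g l‖ := norm_sum_le _ _
      _ = ∑ l ∈ Finset.range (N + 1), ‖f l‖ :=
          Finset.sum_congr rfl fun l hl => by rw [hg_eq l hl]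
      _ ≤ ∑ l ∈ Finset.range (N + 1),
            max B 0 * max CR 0 * τ * ((h * r : ℕ) : ℝ) * P ^ 2 * (D : ℝ) ^ (-((A : ℝ) + 1)) *
              (MeanSquareMajorant.tau 5 l / l) :=
          Finset.sum_le_sum hf_bound
      _ = max B 0 * max CR 0 * τ * ((h * r : ℕ) : ℝ) * P ^ 2 * (D : ℝ) ^ (-((A : ℝ) + 1)) *
            ∑ l ∈ Finset.range (N + 1), MeanSquareMajorant.tau 5 l / l := by
          rw [Finset.mul_sum]
      _ ≤ _ := by
          rw [← hIcc]
          exact mul_le_mul_of_nonneg_left htauSum hcoef0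
  -- absorb the `𝓛`-powers into one power of `D`
  have habs' : max B 0 * max CR 0 * K * 3 ^ 5 * L ^ 45 ≤ D := habs D hDabs
  have hhead : ‖∑ l ∈ Finset.range (N + 1), g l‖ ≤
      τ * ((h * r : ℕ) : ℝ) * P ^ 2 * (D : ℝ) ^ (-(A : ℝ)) := by
    have hsplitpow : (D : ℝ) ^ (-((A : ℝ) + 1)) = (D : ℝ) ^ (-(A : ℝ)) * ((D : ℝ))⁻¹ := by
      rw [show (-((A : ℝ) + 1)) = (-(A : ℝ)) + (-1) by ring, Real.rpow_add hD0,
        Real.rpow_neg_one]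
    have hbase : 0 ≤ τ * ((h * r : ℕ) : ℝ) * P ^ 2 * (D : ℝ) ^ (-(A : ℝ)) := by positivity
    have hinv : 0 ≤ ((D : ℝ))⁻¹ := by positivity
    calc ‖∑ l ∈ Finset.range (N + 1), g l‖
        ≤ max B 0 * max CR 0 * τ * ((h * r : ℕ) : ℝ) * P ^ 2 * (D : ℝ) ^ (-((A : ℝ) + 1)) *
            (K * 3 ^ 5 * L ^ 45) := hsum_g
      _ = (max B 0 * max CR 0 * K * 3 ^ 5 * L ^ 45) * ((D : ℝ))⁻¹ *
            (τ * ((h * r : ℕ) : ℝ) * P ^ 2 * (D : ℝ) ^ (-(A : ℝ))) := by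
          rw [hsplitpow]; ring
      _ ≤ (D : ℝ) * ((D : ℝ))⁻¹ * (τ * ((h * r : ℕ) : ℝ) * P ^ 2 * (D : ℝ) ^ (-(A : ℝ))) :=
          mul_le_mul_of_nonneg_right (mul_le_mul_of_nonneg_right habs' hinv) hbase
      _ = τ * ((h * r : ℕ) : ℝ) * P ^ 2 * (D : ℝ) ^ (-(A : ℝ)) := by
          rw [mul_inv_cancel₀ (ne_of_gt hD0), one_mul]
  -- the tail: `exp(−c𝓛¹⁰) ≤ D^{−A}` once `A/cT + 1 ≤ 𝓛`
  have htailb : ‖tail7P2 c' D a₁ r h d θ‖ ≤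
      τ * ((h * r : ℕ) : ℝ) * P ^ 2 * (D : ℝ) ^ (-(A : ℝ)) := by
    have hT := hTail D χ hDT hq hp hA a₁ ha d h r θ hd hh hr hhrT hdP
    have hLge : (A : ℝ) / cT + 1 ≤ L := htail9 D hDtail
    have hexp : Real.exp (-cT * L ^ 10) ≤ (D : ℝ) ^ (-(A : ℝ)) := by
      rw [Real.rpow_def_of_pos hD0]
      refine Real.exp_le_exp.2 ?_
      have hlogD : Real.log (D : ℝ) = L := rfl
      rw [hlogD]
      have h1 : (A : ℝ) ≤ cT * L := by
        have h2 : (A : ℝ) / cT ≤ L := by linarith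
        calc (A : ℝ) = cT * ((A : ℝ) / cT) := by field_simp
          _ ≤ cT * L := mul_le_mul_of_nonneg_left h2 (le_of_lt hcT)
      have hL8 : (1 : ℝ) ≤ L ^ 8 := one_le_pow₀ hL1
      have h3 : (A : ℝ) * L ≤ cT * L ^ 10 := by
        have hstep : (A : ℝ) * L ≤ (cT * L) * L := mul_le_mul_of_nonneg_right h1 hL0
        have hstep2 : (cT * L) * L ≤ cT * L ^ 10 := by
          have hLL : L * L ≤ L ^ 10 := by
            calc L * L = L ^ 2 := (sq L).symm
              _ = L ^ 2 * 1 := (mul_one _).symm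
              _ ≤ L ^ 2 * L ^ 8 := by
                  exact mul_le_mul_of_nonneg_left hL8 (by positivity)
              _ = L ^ 10 := by ring
          calc (cT * L) * L = cT * (L * L) := by ring
            _ ≤ cT * L ^ 10 := mul_le_mul_of_nonneg_left hLL (le_of_lt hcT)
        exact hstep.trans hstep2
      linarith
    have hP2 : (1 : ℝ) ≤ P ^ 2 := one_le_pow₀ hP1
    calc ‖tail7P2 c' D a₁ r h d θ‖ ≤ Real.exp (-cT * L ^ 10) := by
          simpa using hT
      _ ≤ (D : ℝ) ^ (-(A : ℝ)) := hexp
      _ = 1 * 1 * 1 * (D : ℝ) ^ (-(A : ℝ)) := by ring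
      _ ≤ τ * ((h * r : ℕ) : ℝ) * P ^ 2 * (D : ℝ) ^ (-(A : ℝ)) := by gcongr
  -- combine
  calc ‖frakS c' D a₁ r h d θ‖
      = ‖∑ l ∈ Finset.range (N + 1), g l + tail7P2 c' D a₁ r h d θ‖ := by rw [hsplit]
    _ ≤ ‖∑ l ∈ Finset.range (N + 1), g l‖ + ‖tail7P2 c' D a₁ r h d θ‖ := norm_add_le _ _
    _ ≤ τ * ((h * r : ℕ) : ℝ) * P ^ 2 * (D : ℝ) ^ (-(A : ℝ)) +
          τ * ((h * r : ℕ) : ℝ) * P ^ 2 * (D : ℝ) ^ (-(A : ℝ)) := add_le_add hhead htailb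
    _ = 2 * τ * ((h * r : ℕ) : ℝ) * P ^ 2 * (D : ℝ) ^ (-(A : ℝ)) := by ring

end Literature.NumberTheory.LFunctions.Zhang2022.Section7cStatements
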